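import Summits.BirchSwinnertonDyer.BirchSwinnertonDyer.Theorems.AlignedTransportAtTwoMainConjectureOfRankZeroBSDAtTwoCubicOrderFourRowN13547Exact
import HarnessLib

/-!
# Route `AlignedTransportAtTwo`, crux C2 `MainConjectureOfRankZeroBSDAtTwo` (stmt-BirchSwinnertonDyer-22298):
# THE WHOLE `2`-CLASS-NUMBER TOWER of the cubic `2`-torsion field of `⟨1, 0, 1, -121, 499⟩` (`N = 13547`): `ord₂ h(K_m) = 2` for EVERY layer `m ≥ 1`
# of EVERY cyclotomic `ℤ₂`-extension — UNCONDITIONAL (layer-one unit door ∘ order-four certificate ∘ genus bit)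

HONEST FRAMING (cell `bsd-f1-sign2`, WIDTH-5 attached prover seat `bsd-line-att-p4` gen 40 on line `birth` of the lead `bsd-line-att-p2`;
`--supports` stmt-BirchSwinnertonDyer-22298, closes nothing; BSD is NOT proved by any of this; the crux C2, its verdict «blocked-on
`Rank1Residual.GreenbergMuConjectureIrreducible`» and every registered stub are untouched).  THEOREMS ONLY (no `def`, no named fact, no instance, no `sorry`).

WHAT.  att-p4 g39's layer-one row (`…CubicLayerOneRowN13547.classNumberPExp_eq_and_mu_lambda_eq_zero_cubicField_n13547`, att-p3 g41's layer-one unit door)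
proved `e_m = e_1` for all `m ≥ 1`, `μ₂ = 0`, `λ₂ = 0` (the Iwasawa module `X` is FINITE); this seat's order-four certificate with genus bit
(`…CubicOrderFourRowN13547Exact.classNumberPExp_one_cubicField_n13547_eq_two`) proved `e_1 = 2`.  Together:
* ★★ `classNumberPExp_cubicField_n13547_eq_two` — for `β` ANY root of the `2`-division cubic of `⟨1,0,1,−121,499⟩`, EVERY cyclotomic `ℤ₂`-extension `κ` of
  `ℚ(β)` and EVERY `m ≥ 1`: `classNumberPExp κ m = 2`, i.e. `#Cl(K_m)[2^∞] = 4` in every layer (and `rank₂ ≤ 1` there by Gras: `Cl(K_m)[2^∞] ≅ ℤ/4`,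
  `X ≅ ℤ/4`) — NO hypothesis.
Nothing is asserted about `MC₂` beyond the existing rows; BSD is NOT proved; nothing is closed.

References: [Fukuda1994] Thm. 1 (1); [Washington1997] §13.3; [Gras2003] IV.4; [LMFDB] nf 3.1.13547.1, ec 13547; tree: att-p4 g39 `…CubicLayerOneRowN13547`,
att-p4 g40 `…CubicOrderFourRowN13547{Data,Certs,,Exact}`.
-/

set_option linter.dupNamespace false
set_option autoImplicit false

noncomputable section

open scoped Classical NumberField nonZeroDivisors IntermediateField

namespace Summit.BirchSwinnertonDyer.BirchSwinnertonDyer.Theorems.AlignedTransportAtTwoCubicOrderFourRowN13547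

open NumberField IsDedekindDomain Polynomial WeierstrassCurve IntermediateField Module
  Literature.NumberTheory.IwasawaTheory Literature.NumberTheory.EllipticCurves Literature.NumberTheory.NumberFields
  Summit.BirchSwinnertonDyer.BirchSwinnertonDyer.Theorems.AlignedTransportAtTwoCubicLayerOneRowN13547

/-- ★★ **`ord₂ h(K_m) = 2` FOR EVERY LAYER `m ≥ 1`** of every cyclotomic `ℤ₂`-extension of the cubic `2`-torsion field of `⟨1,0,1,−121,499⟩` (discriminant
`−13547`) — UNCONDITIONAL: `e_m = e_1` (layer-one unit door, att-p4 g39 / att-p3 g41) and `e_1 = 2` (order-four certificate + genus bit, this seat).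
[cite: Fukuda1994, Thm. 1 (1), p. 264] [cite: Gras2003, IV.4] [cite: LMFDB, number field 3.1.13547.1 (class number 1)] -/
theorem classNumberPExp_cubicField_n13547_eq_two {β : AlgebraicClosure ℚ}
    (hβ : aeval β ((⟨1, 0, 1, -121, 499⟩ : WeierstrassCurve ℤ).baseChange ℚ).twoTorsionPolynomial.toPoly = 0)
    (κP : ZpExtension ↥(IntermediateField.adjoin ℚ ({β} : Set (AlgebraicClosure ℚ))) 2) (hκP : κP.IsCyclotomic)
    (m : ℕ) (hm : 1 ≤ m) : classNumberPExp κP m = 2 := by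
  rw [(classNumberPExp_eq_and_mu_lambda_eq_zero_cubicField_n13547 hβ κP hκP).1 m hm]
  exact classNumberPExp_one_cubicField_n13547_eq_two hβ κP hκP

end Summit.BirchSwinnertonDyer.BirchSwinnertonDyer.Theorems.AlignedTransportAtTwoCubicOrderFourRowN13547

end
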